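import Mathlib
import HarnessLib
import Summits.HubbardSuperconductivity.HubbardSuperconductivity.Theorems.KLProgrammeKLRegimeSplitFieldStrengthSectorTelescope
import Summits.HubbardSuperconductivity.HubbardSuperconductivity.Theorems.KLProgrammeKLRegimeEnginePlaneWavePhases
import Literature.Probability.LatticeModels.TorusFourierMomentBound

/-!
# Route `KLProgramme` — ENGINE child gen 8 (stmt-HubbardSuperconductivity-20437 `KLRegimeEngineV17F2`), class #7, SPACE row in sector-pinned currency:
# a LIPSCHITZ bound for the self-energy between two lattice momenta resolved by the same sectors, from the sector-pinned SPATIAL first moment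
# (cell gate-hubbard-kl, seat hubbard-kl-k3c2-p3 g8; memo W3-CURRENCY.md §4(c) — the local reading that the sector currency supports)

WHY.  Row B2′ of stub (e) reads the gradient of the GLOBAL trigonometric interpolant `symInterp L (klLocSelfEnergyRe − K∘p)` on the shell tube; its
cosine coefficients are the PLAIN position-space two-leg kernel (`torusCosCoeff`), so that reading is intrinsically plain-currency — and in plain currency the
per-scale decay of the two-leg increments is out of reach of sectorised bounds (BGM 2006 Thm 2.1 (2.77), `F = 0` vs `F = 1`).  What the SECTOR-PINNED currency
does control (BGM §3 (3.6) is a `sup_{ω̄}` bound) is a LOCAL reading: the variation of `Σ̂(ν, ·)` between two lattice momenta `p⃗, p⃗′` that are resolved by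
the same small label set `A` (`Σ_{ω∈A} F_ω(ν,p⃗) = 1 = Σ_{ω∈A} F_ω(ν,p⃗′)` — two points of one plateau cluster).  By the same Fourier inversion as the time row
(`card_sq_mul_kernel_two_eq_sum_sum`), the testing phases of `(ν,p⃗)` and `(ν,p⃗′)` differ by `χ_{p⃗−p⃗′}(x⃗₀−x⃗₁) − 1`, of norm
`≤ Σ_b 2π|(p⃗−p⃗′)~_b|·|(x⃗₀−x⃗₁)~_b|/L ≤ dist(p⃗,p⃗′)·|Δx̃|₁` (`EngineV8.norm_torusChar_sub_one_le`; `dist(p⃗,p⃗′) = (2π/L)·max_b |(p⃗−p⃗′)~_b|` the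
torus distance of the lattice momenta, `|Δx̃|₁ = |Δx̃₀| + |Δx̃₁|` the centred lattice distance):

  **`‖Σ(ν,p⃗,σ) − Σ(ν,p⃗′,σ)‖ ≤ 2·dist(p⃗,p⃗′)·Σ_{ω∈A} Mˢ_ω`**

whenever the `F`-sectorised two-leg kernel, leg `0` pinned at `(x₀, ω)` (`ω ∈ A`), leg `1` summed over positions and `ω′ ∈ A`, has spatial first moment
`ε_x Σ_{x : x 0 = x₀} Σ_{ω′∈A} |Δx̃|₁·‖W_{2,((ω,σ),+),((ω′,σ),−)}(x)‖ ≤ Mˢ_ω` — a Lipschitz constant `2·Σ_{ω∈A} Mˢ_ω` (≤ 4·max, `#A ≤ 2` by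
`card_filter_klAnisoFamily_ne_zero_le_two`).  Applied increment by increment (`selfEnergy_sub`) with the levels decay of the sector-pinned moments this is
n-free and `O(U²)` like the time row.  Whether B2′ is re-keyed to such a local reading is the text owner's decision; this file supplies the bridge.
Everything is PROVED; no definitions; nothing about the model is asserted.
References: BGM 2006 §2.1 (2.5), (2.36), Thm 2.1 (2.77), §3 (3.5)–(3.6) [cite: BenfattoGiulianiMastropietro2006].
-/

noncomputable section

namespace Summit.HubbardSuperconductivity.HubbardSuperconductivity.Theorems.TwoLegFourier

set_option linter.dupNamespace false -- summit = problem name (single-conjunct summit), D-0017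

open Finset Complex
open Literature.MathematicalPhysics.QuantumLattice Literature.Probability.LatticeModels GrassmannAlgebra
open Summit.HubbardSuperconductivity.HubbardSuperconductivity.Theorems.KLRegimeSplit

variable {L M N : ℕ}

/-! ## §1 The two testing phases at the same frequency differ by a spatial character -/

/-- **Phase difference between two momenta at one frequency**: for `K = (ν,p⃗)`, `K′ = (ν,p⃗′)`,
`‖conj(pw⁺pw⁻)(K) − conj(pw⁺pw⁻)(K′)‖ = ‖χ_{p⃗−p⃗′}(y⃗−y⃗′) − 1‖ ≤ Σ_b 2π·|(p⃗−p⃗′)~_b|·|(y⃗−y⃗′)~_b|/L`. -/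
theorem norm_conj_phase_sub_conj_phase_le [NeZero L] (β : ℝ) (ν : MatsubaraIdx M) (p p' : TorusSite 2 L) (y y' : SpaceTimeIdx L M) :
    ‖(starRingEnd ℂ) (hubbardPlaneWave L M β 0 (ν, p) y * hubbardPlaneWave L M β 1 (ν, p) y') -
        (starRingEnd ℂ) (hubbardPlaneWave L M β 0 (ν, p') y * hubbardPlaneWave L M β 1 (ν, p') y')‖ ≤
      ∑ b : Fin 2, 2 * Real.pi * |(((p - p') b).valMinAbs : ℝ)| * |(((y.2 - y'.2) b).valMinAbs : ℝ)| / L := by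
  rw [conj_phase_eq_cexp_mul_torusChar, conj_phase_eq_cexp_mul_torusChar]
  simp only []
  have hp : torusChar p (y.2 - y'.2) = torusChar p' (y.2 - y'.2) * torusChar (p - p') (y.2 - y'.2) := by
    rw [← torusChar_add_left, add_sub_cancel]
  rw [hp, ← mul_assoc, ← mul_sub_one, norm_mul, norm_mul, Complex.norm_exp_ofReal_mul_I, norm_torusChar, one_mul, one_mul]
  exact EngineV8.norm_torusChar_sub_one_le (p - p') (y.2 - y'.2)

/-- The coordinate sum against `sup × ℓ¹`: `Σ_b 2π|q̃_b||z̃_b|/L ≤ (2π/L)·(|q̃₀| ⊔ |q̃₁|)·(|z̃₀| + |z̃₁|)`. [folklore] -/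
theorem sum_two_pi_mul_abs_mul_abs_div_le [NeZero L] (q z : TorusSite 2 L) :
    ∑ b : Fin 2, 2 * Real.pi * |((( q b).valMinAbs : ℤ) : ℝ)| * |(((z b).valMinAbs : ℤ) : ℝ)| / L ≤
      2 * Real.pi / L * (max |(((q 0).valMinAbs : ℤ) : ℝ)| |(((q 1).valMinAbs : ℤ) : ℝ)|) *
        (|(((z 0).valMinAbs : ℤ) : ℝ)| + |(((z 1).valMinAbs : ℤ) : ℝ)|) := by
  have hL : (0 : ℝ) < L := by exact_mod_cast Nat.pos_of_ne_zero (NeZero.ne L)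
  rw [Fin.sum_univ_two]
  have h0 : |(((q 0).valMinAbs : ℤ) : ℝ)| ≤ max |(((q 0).valMinAbs : ℤ) : ℝ)| |(((q 1).valMinAbs : ℤ) : ℝ)| := le_max_left _ _
  have h1 : |(((q 1).valMinAbs : ℤ) : ℝ)| ≤ max |(((q 0).valMinAbs : ℤ) : ℝ)| |(((q 1).valMinAbs : ℤ) : ℝ)| := le_max_right _ _
  have hz0 : 0 ≤ |(((z 0).valMinAbs : ℤ) : ℝ)| := abs_nonneg _
  have hz1 : 0 ≤ |(((z 1).valMinAbs : ℤ) : ℝ)| := abs_nonneg _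
  have hπ : 0 < 2 * Real.pi / L := by positivity
  rw [show 2 * Real.pi * |(((q 0).valMinAbs : ℤ) : ℝ)| * |(((z 0).valMinAbs : ℤ) : ℝ)| / L =
      2 * Real.pi / L * (|(((q 0).valMinAbs : ℤ) : ℝ)| * |(((z 0).valMinAbs : ℤ) : ℝ)|) by ring,
    show 2 * Real.pi * |(((q 1).valMinAbs : ℤ) : ℝ)| * |(((z 1).valMinAbs : ℤ) : ℝ)| / L =
      2 * Real.pi / L * (|(((q 1).valMinAbs : ℤ) : ℝ)| * |(((z 1).valMinAbs : ℤ) : ℝ)|) by ring, ← mul_add, mul_assoc]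
  refine mul_le_mul_of_nonneg_left ?_ hπ.le
  nlinarith [mul_le_mul_of_nonneg_right h0 hz0, mul_le_mul_of_nonneg_right h1 hz1]

/-! ## §2 The Lipschitz bound from the sector-pinned spatial first moment -/

/-- **THE SELF-ENERGY IS LIPSCHITZ ON A PLATEAU CLUSTER, SECTOR-PINNED**: for `β > 0`, any `G`, any family `F`, a label set `A` resolving the identity at BOTH
`(ν,p⃗)` and `(ν,p⃗′)`, spin `σ`: if for every `ω ∈ A` the `F`-sectorised two-leg kernel, leg `0` pinned at `(x₀, ω)`, leg `1` summed over positions and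
`ω′ ∈ A`, has spatial first moment `ε_x Σ_{x : x 0 = x₀} Σ_{ω′∈A} (|Δx̃₀| + |Δx̃₁|)·‖W_{2,((ω,σ),+),((ω′,σ),−)}(x)‖ ≤ Mˢ ω` for every `x₀`, then
`‖Σ(ν,p⃗,σ) − Σ(ν,p⃗′,σ)‖ ≤ 2·(2π/L)·max_b |(p⃗−p⃗′)~_b| · Σ_{ω∈A} Mˢ ω`. [cite: BenfattoGiulianiMastropietro2006, §3 (3.5)–(3.6)] -/
theorem norm_selfEnergy_sub_selfEnergy_le_of_sector_space_moment [NeZero L] [NeZero M] {β : ℝ} (hβ : 0 < β)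
    (F : Fin N → FreqMomentum L M → ℂ) (G : HubbardGrassmann L M) (ν : MatsubaraIdx M) (p p' : TorusSite 2 L) (σ : Fin 2) {A : Finset (Fin N)}
    (hA : ∑ ω ∈ A, F ω (ν, p) = 1) (hA' : ∑ ω ∈ A, F ω (ν, p') = 1) {Ms : Fin N → ℝ}
    (hMs : ∀ ω ∈ A, ∀ x₀ : SpaceTimeIdx L M, imagTimeWeight β M *
      ∑ x ∈ (univ : Finset (Fin 2 → SpaceTimeIdx L M)).filter (fun x => x 0 = x₀), ∑ ω' ∈ A,
        (|((((x 0).2 - (x 1).2) 0).valMinAbs : ℝ)| + |((((x 0).2 - (x 1).2) 1).valMinAbs : ℝ)|) *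
          ‖sectorisedKernel L M β F G 2 (![((ω, σ), 0), ((ω', σ), 1)] : Fin 2 → SectorLeg N) x‖ ≤ Ms ω) :
    ‖selfEnergy L M β G (ν, p) σ - selfEnergy L M β G (ν, p') σ‖ ≤
      2 * (2 * Real.pi / L * max |(((p - p') 0).valMinAbs : ℝ)| |(((p - p') 1).valMinAbs : ℝ)|) * ∑ ω ∈ A, Ms ω := by
  set P : ℝ := (Fintype.card (SpaceTimeIdx L M) : ℝ) with hP
  have hPpos : 0 < P := by
    rw [hP]; exact_mod_cast (Fintype.card_pos_iff.2 ⟨(ν, p)⟩ : 0 < Fintype.card (SpaceTimeIdx L M))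
  have hε : 0 ≤ imagTimeWeight β M := imagTimeWeight_nonneg hβ.le M
  have hεP : imagTimeWeight β M * P = β * (L : ℝ) ^ 2 := imagTimeWeight_mul_card β L M
  have hεpos : 0 < imagTimeWeight β M := by
    unfold imagTimeWeight
    have : (0 : ℝ) < M := by
      have hM : 0 < 2 * M := ν.pos
      exact_mod_cast Nat.pos_of_mul_pos_left hM
    positivity
  set D : ℝ := 2 * Real.pi / L * max |(((p - p') 0).valMinAbs : ℝ)| |(((p - p') 1).valMinAbs : ℝ)| with hD
  have hD0 : 0 ≤ D := by rw [hD]; exact mul_nonneg (by positivity) (le_max_of_le_left (abs_nonneg _))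
  set c : FreqMomentum L M → (Fin 2 → SpaceTimeIdx L M) → ℂ := fun K x =>
    (starRingEnd ℂ) (hubbardPlaneWave L M β 0 K (x 0) * hubbardPlaneWave L M β 1 K (x 1)) with hc
  -- the difference of the two coefficients as one position-space sum over `A × A`
  have hdiff : (P : ℂ) ^ 2 * (kernel ℂ G 2 ![(((ν, p), σ), 0), (((ν, p), σ), 1)] - kernel ℂ G 2 ![(((ν, p'), σ), 0), (((ν, p'), σ), 1)]) =
      ∑ ω ∈ A, ∑ ω' ∈ A, ∑ x : Fin 2 → SpaceTimeIdx L M,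
        sectorisedKernel L M β F G 2 (![((ω, σ), 0), ((ω', σ), 1)] : Fin 2 → SectorLeg N) x * (c (ν, p) x - c (ν, p') x) := by
    have h1 := card_sq_mul_kernel_two_eq_sum_sum hβ.ne' F G (ν, p) σ hA
    have h2 := card_sq_mul_kernel_two_eq_sum_sum hβ.ne' F G (ν, p') σ hA'
    have hPc : ((Fintype.card (SpaceTimeIdx L M) : ℕ) : ℂ) = (P : ℂ) := by rw [hP]; norm_cast
    rw [hPc] at h1 h2
    rw [mul_sub, h1, h2, ← sum_sub_distrib]
    refine sum_congr rfl fun ω _ => ?_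
    rw [← sum_sub_distrib]
    refine sum_congr rfl fun ω' _ => ?_
    rw [← sum_sub_distrib]
    exact sum_congr rfl fun x _ => by rw [hc]; ring
  -- norm of the position-space sum
  have hsum : ‖∑ ω ∈ A, ∑ ω' ∈ A, ∑ x : Fin 2 → SpaceTimeIdx L M,
        sectorisedKernel L M β F G 2 (![((ω, σ), 0), ((ω', σ), 1)] : Fin 2 → SectorLeg N) x * (c (ν, p) x - c (ν, p') x)‖ ≤
      D * ∑ ω ∈ A, ∑ ω' ∈ A, ∑ x : Fin 2 → SpaceTimeIdx L M,
        (|((((x 0).2 - (x 1).2) 0).valMinAbs : ℝ)| + |((((x 0).2 - (x 1).2) 1).valMinAbs : ℝ)|) *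
          ‖sectorisedKernel L M β F G 2 (![((ω, σ), 0), ((ω', σ), 1)] : Fin 2 → SectorLeg N) x‖ := by
    calc ‖∑ ω ∈ A, ∑ ω' ∈ A, ∑ x : Fin 2 → SpaceTimeIdx L M,
          sectorisedKernel L M β F G 2 (![((ω, σ), 0), ((ω', σ), 1)] : Fin 2 → SectorLeg N) x * (c (ν, p) x - c (ν, p') x)‖
        ≤ ∑ ω ∈ A, ∑ ω' ∈ A, ∑ x : Fin 2 → SpaceTimeIdx L M, D *
            ((|((((x 0).2 - (x 1).2) 0).valMinAbs : ℝ)| + |((((x 0).2 - (x 1).2) 1).valMinAbs : ℝ)|) *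
              ‖sectorisedKernel L M β F G 2 (![((ω, σ), 0), ((ω', σ), 1)] : Fin 2 → SectorLeg N) x‖) := by
          refine (norm_sum_le _ _).trans (sum_le_sum fun ω _ => (norm_sum_le _ _).trans (sum_le_sum fun ω' _ =>
            (norm_sum_le _ _).trans (sum_le_sum fun x _ => ?_)))
          rw [norm_mul, hc]
          simp only []
          have hph := (norm_conj_phase_sub_conj_phase_le (M := M) β ν p p' (x 0) (x 1)).trans
            (sum_two_pi_mul_abs_mul_abs_div_le (p - p') ((x 0).2 - (x 1).2))
          have hW0 : 0 ≤ ‖sectorisedKernel L M β F G 2 (![((ω, σ), 0), ((ω', σ), 1)] : Fin 2 → SectorLeg N) x‖ := norm_nonneg _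
          calc ‖sectorisedKernel L M β F G 2 (![((ω, σ), 0), ((ω', σ), 1)] : Fin 2 → SectorLeg N) x‖ * ‖c (ν, p) x - c (ν, p') x‖
              ≤ ‖sectorisedKernel L M β F G 2 (![((ω, σ), 0), ((ω', σ), 1)] : Fin 2 → SectorLeg N) x‖ *
                  (D * (|((((x 0).2 - (x 1).2) 0).valMinAbs : ℝ)| + |((((x 0).2 - (x 1).2) 1).valMinAbs : ℝ)|)) :=
                mul_le_mul_of_nonneg_left (by simpa only [hD, Int.cast_abs] using hph) hW0
            _ = _ := by ring
      _ = D * ∑ ω ∈ A, ∑ ω' ∈ A, ∑ x : Fin 2 → SpaceTimeIdx L M,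
            (|((((x 0).2 - (x 1).2) 0).valMinAbs : ℝ)| + |((((x 0).2 - (x 1).2) 1).valMinAbs : ℝ)|) *
              ‖sectorisedKernel L M β F G 2 (![((ω, σ), 0), ((ω', σ), 1)] : Fin 2 → SectorLeg N) x‖ := by
          simp only [mul_sum]
  -- slice by the position of leg 0 and use the hypothesis
  have hslice : ∑ ω ∈ A, ∑ ω' ∈ A, ∑ x : Fin 2 → SpaceTimeIdx L M,
        (|((((x 0).2 - (x 1).2) 0).valMinAbs : ℝ)| + |((((x 0).2 - (x 1).2) 1).valMinAbs : ℝ)|) *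
          ‖sectorisedKernel L M β F G 2 (![((ω, σ), 0), ((ω', σ), 1)] : Fin 2 → SectorLeg N) x‖ ≤
      P * (∑ ω ∈ A, Ms ω) / imagTimeWeight β M := by
    rw [le_div_iff₀ hεpos, sum_mul, mul_sum]
    refine sum_le_sum fun ω hω => ?_
    rw [sum_comm, ← sum_fiberwise_of_maps_to (s := univ) (t := (univ : Finset (SpaceTimeIdx L M))) (g := fun x => x 0)
      (fun _ _ => mem_univ _), sum_mul]
    have hP' : P * Ms ω = ∑ _x₀ : SpaceTimeIdx L M, Ms ω := by rw [sum_const, card_univ, nsmul_eq_mul, hP]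
    rw [hP']
    refine sum_le_sum fun x₀ _ => ?_
    rw [mul_comm]
    exact hMs ω hω x₀
  -- assemble
  rw [selfEnergy_eq_vertexFn, selfEnergy_eq_vertexFn, ← mul_sub, norm_mul, Complex.norm_real, Real.norm_eq_abs,
    abs_of_nonneg (by positivity)]
  have hker : ‖kernel ℂ G 2 ![(((ν, p), σ), 0), (((ν, p), σ), 1)] - kernel ℂ G 2 ![(((ν, p'), σ), 0), (((ν, p'), σ), 1)]‖ ≤
      D * (P * (∑ ω ∈ A, Ms ω) / imagTimeWeight β M) / P ^ 2 := by
    rw [le_div_iff₀ (by positivity), mul_comm]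
    have h := congrArg (fun z : ℂ => ‖z‖) hdiff
    simp only [norm_mul, norm_pow, Complex.norm_real, Real.norm_eq_abs, abs_of_pos hPpos] at h
    rw [h]
    exact hsum.trans (mul_le_mul_of_nonneg_left hslice hD0)
  calc 2 * (β * (L : ℝ) ^ 2) * ‖kernel ℂ G 2 ![(((ν, p), σ), 0), (((ν, p), σ), 1)] - kernel ℂ G 2 ![(((ν, p'), σ), 0), (((ν, p'), σ), 1)]‖
      ≤ 2 * (β * (L : ℝ) ^ 2) * (D * (P * (∑ ω ∈ A, Ms ω) / imagTimeWeight β M) / P ^ 2) := mul_le_mul_of_nonneg_left hker (by positivity)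
    _ = 2 * D * ∑ ω ∈ A, Ms ω := by
        rw [← hεP]
        field_simp

/-- **INCREMENT FORM** (the local reading of the space row, per increment): under the same resolution hypotheses, with the spatial first moments of the
`F`-sectorised two-leg kernel of the DIFFERENCE `G₁ − G₀`,
`‖(Σ_{G₁} − Σ_{G₀})(ν,p⃗,σ) − (Σ_{G₁} − Σ_{G₀})(ν,p⃗′,σ)‖ ≤ 2·dist(p⃗,p⃗′)·Σ_{ω∈A} Mˢ ω`. -/
theorem norm_selfEnergy_increment_sub_le_of_sector_space_moment [NeZero L] [NeZero M] {β : ℝ} (hβ : 0 < β)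
    (F : Fin N → FreqMomentum L M → ℂ) (G₁ G₀ : HubbardGrassmann L M) (ν : MatsubaraIdx M) (p p' : TorusSite 2 L) (σ : Fin 2)
    {A : Finset (Fin N)} (hA : ∑ ω ∈ A, F ω (ν, p) = 1) (hA' : ∑ ω ∈ A, F ω (ν, p') = 1) {Ms : Fin N → ℝ}
    (hMs : ∀ ω ∈ A, ∀ x₀ : SpaceTimeIdx L M, imagTimeWeight β M *
      ∑ x ∈ (univ : Finset (Fin 2 → SpaceTimeIdx L M)).filter (fun x => x 0 = x₀), ∑ ω' ∈ A,
        (|((((x 0).2 - (x 1).2) 0).valMinAbs : ℝ)| + |((((x 0).2 - (x 1).2) 1).valMinAbs : ℝ)|) *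
          ‖sectorisedKernel L M β F (G₁ - G₀) 2 (![((ω, σ), 0), ((ω', σ), 1)] : Fin 2 → SectorLeg N) x‖ ≤ Ms ω) :
    ‖(selfEnergy L M β G₁ (ν, p) σ - selfEnergy L M β G₀ (ν, p) σ) -
        (selfEnergy L M β G₁ (ν, p') σ - selfEnergy L M β G₀ (ν, p') σ)‖ ≤
      2 * (2 * Real.pi / L * max |(((p - p') 0).valMinAbs : ℝ)| |(((p - p') 1).valMinAbs : ℝ)|) * ∑ ω ∈ A, Ms ω := by
  rw [← selfEnergy_sub, ← selfEnergy_sub]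
  exact norm_selfEnergy_sub_selfEnergy_le_of_sector_space_moment hβ F (G₁ - G₀) ν p p' σ hA hA' hMs

end Summit.HubbardSuperconductivity.HubbardSuperconductivity.Theorems.TwoLegFourier

end
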